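import Summits.BirchSwinnertonDyer.BirchSwinnertonDyer.Theorems.PrintCf2SplitBadTwoCMShaEigenImageSurj
import Summits.BirchSwinnertonDyer.BirchSwinnertonDyer.Theorems.PrintCf2SplitBadTwoCMShaDescentSquare
import Summits.BirchSwinnertonDyer.BirchSwinnertonDyer.Theorems.PrintCf2SplitBadTwoRestrictedSelmerBottomValueOfFactors
import Summits.BirchSwinnertonDyer.BirchSwinnertonDyer.Theorems.PrintCf2SplitBadTwoCMPrimaryConjugationTransport
import HarnessLib

/-!
# Crux `PrintCf2.SplitBadTwoRankOneOfFacts` (item stmt-BirchSwinnertonDyer-20368), road α, S3c₂ bottom value: factor (F2) ON THE FRAME,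
# modulo the two displayed local CM inputs at the primes above `2`

Cell `bsd-print-cf2`, width seat `bsd-line-cf2-p1-w8` g2 (brick **B6f**, assembly); `--supports stmt-BirchSwinnertonDyer-20368` (helper,
Theses-free). HONEST FRAMING: nothing here closes a crux or a stub; BSD is not proved by any of this; no summit statement is proved by this
seat. No definition, no named fact, no `sorry`. beyond-print theorem: no.

WHAT THIS FILE DOES. -w7 g2's `RestrictedSelmerPair.rBV_of_three_factor_values` takes factor (F2) of the bottom value as the hypothesis
`hF2 : ∀ frame, v₂ #((𝔖_v(K, E[𝔮^∞]) ⊓ L_M) ⧸ Q_M) = v₂ #Ш(W/ℚ)[2^∞]`. Here (F2) is DERIVED on every S3c₂ frame (member `C • W = cm7^{(d)}`,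
`d ≠ 0`, `K` imaginary quadratic, `2 = v·v̄`, `π ∈ End_K(E_K)` with `π² = π − 2`, `r² = r − 2`) from exactly two displayed local CM inputs
(Hv), (Hv̄) at `v`, `v̄` (the `M`-component of a `v`-classical class dies on `⊤ ⊓ D_v`; the `M`-component of a `v̄`-classical class is
`v̄`-classical) — everything else the frame supplies:
* `φ = π` as an endo-isogeny (`exists_isogeny_apply_eq_cmEndo`), complementarity `M ⊓ M̄ = ⊥`, `M ⊔ M̄ = ⊤`
  (`endEigenPrimaryTorsion_compl_of_frame`), `2r − 1 ∈ ℤ₂ˣ` (`two_dvd_or_two_dvd_one_sub_of_root`), `2 = v·v̄` exactly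
  (`eq_or_eq_of_two_mem`), `√−7 ∈ K` and `j = −3375` (`exists_sq_eq_neg_seven_of_frame_cmEndo`, `j_eq_of_smul_eq_cm7Twist`);
* THE `r`-eigen subgroup `C ≤ Ш(E_K/K)[2^∞]` and its partner (`exists_shaPi_two`, `exists_addSubgroup_eigen`);
* `#((𝔖_v ⊓ L_M) ⧸ Q_M) = #f(𝔖_v ⊓ L_M)` (-w7 g2 `natCard_trueSelmer_quotient_eq_natCard_range_shaMap`) `= #C` (this seat's B6f,
  `natCard_range_shaBridge_trueSelmer_eq`, p667242 + p668410) `= #Ш(W/ℚ)[2^∞]` (this seat's B6e, `natCard_cmPrimary_sha_eq_of_isogeny`, p665921).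

Main results: `natCard_trueSelmer_quotient_eq_sha_of_frame` (`Nat.card` form, no finiteness) and
`padicValNat_trueSelmer_quotient_eq_sha_of_frame` (the `v₂` form — the inner statement of `hF2` VERBATIM, under (Hv), (Hv̄)).

References: A. Agboola, Compositio 143 (2007) §6 Props. 6.10–6.11 [Agboola2007]; B. Gross, LMS LN 153 (1991) §5 [GrossLMS1991];
K. Rubin, LNM 1716 (1999) §2 [Rubin1999].
-/

noncomputable section

open scoped Classical

set_option linter.dupNamespace false
set_option autoImplicit false

namespace Summit.BirchSwinnertonDyer.BirchSwinnertonDyer.Theorems.PrintCf2.CMPrimes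

open Literature.NumberTheory.EllipticCurves Literature.NumberTheory.GaloisRepresentations Field NumberField IsDedekindDomain
open Literature.NumberTheory.EllipticCurves.ResKernel Literature.NumberTheory.EllipticCurves.GreenbergSelmer
open Literature.NumberTheory.EllipticCurves.Agboola2007
open Summit.BirchSwinnertonDyer.BirchSwinnertonDyer.Theorems.PrintCf2.RestrictedSelmerPair
open Summit.BirchSwinnertonDyer.BirchSwinnertonDyer.Theorems.PrintCf2.AdditiveAtSeven

variable {K : Type} [Field K] [NumberField K]

/-- **Factor (F2) on the frame, `Nat.card` form.** For a member `C • W = cm7^{(d)}` (`d ≠ 0`) over an imaginary quadratic `K` with `2 = v·v̄`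
(`v̄ ≠ v`), `π ∈ End_K(E_K)` with `π² = π − 2`, `r ∈ ℤ₂` with `r² = r − 2`, and `M = E[𝔮_r^∞]`, `L_M = ι_*⁻¹(localKerOver 2 ⊤ K_{v̄})`,
`Q_M = ι_*⁻¹(res_⊤(range κ))`: GRANTED the two displayed local CM inputs (Hv), (Hv̄) at the primes above `2`,
`#((𝔖_v(K, M) ⊓ L_M) ⧸ Q_M) = #Ш(W/ℚ)[2^∞]` (`Nat.card`, no finiteness assumed). [cite: Agboola2007, Props. 6.10–6.11 (arXiv p0014:L1–p0015:L12)]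
[cite: GrossLMS1991, §5 (5.1)] -/
theorem natCard_trueSelmer_quotient_eq_sha_of_frame {d : ℤ} (hd0 : d ≠ 0) (W : WeierstrassCurve ℚ) [W.IsElliptic]
    (C : WeierstrassCurve.VariableChange ℚ) (hCW : C • W = cm7.quadraticTwist (d : ℚ)) (hK : IsImaginaryQuadratic K)
    (v vbar : HeightOneSpectrum (𝓞 K)) (hv : ((2 : ℕ) : 𝓞 K) ∈ v.asIdeal) (hvbar : ((2 : ℕ) : 𝓞 K) ∈ vbar.asIdeal) (hne : vbar ≠ v)
    (π : (W.baseChange K).endRing) (hrel : (π : AddMonoid.End (W.baseChange K).geomPoints) * π = π - 2)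
    {r : ℤ_[2]} (hr : r * r = r - 2)
    (Hv : ∀ (η : subgroupH1 (⊤ : Subgroup (absoluteGaloisGroup K)) ↥((W.baseChange K).geomPrimaryTorsion 2))
      (c : subgroupH1 (⊤ : Subgroup (absoluteGaloisGroup K)) ↥((W.baseChange K).endEigenPrimaryTorsion 2 π r))
      (c' : subgroupH1 (⊤ : Subgroup (absoluteGaloisGroup K)) ↥((W.baseChange K).endEigenPrimaryTorsion 2 π (1 - r))),
      η ∈ (W.baseChange K).localKerOver 2 ⊤ (v.adicCompletion K) →
      η = resH1Hom (ContinuousMonoidHom.id _) ((W.baseChange K).endEigenPrimaryTorsion 2 π r).subtype (fun _ _ ↦ rfl) c +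
        resH1Hom (ContinuousMonoidHom.id _) ((W.baseChange K).endEigenPrimaryTorsion 2 π (1 - r)).subtype (fun _ _ ↦ rfl) c' →
      Literature.NumberTheory.EllipticCurves.resOfLe ↥((W.baseChange K).endEigenPrimaryTorsion 2 π r)
        (inf_le_left : ⊤ ⊓ decomp v ≤ ⊤) c = 0)
    (Hvbar : ∀ (η : subgroupH1 (⊤ : Subgroup (absoluteGaloisGroup K)) ↥((W.baseChange K).geomPrimaryTorsion 2))
      (c : subgroupH1 (⊤ : Subgroup (absoluteGaloisGroup K)) ↥((W.baseChange K).endEigenPrimaryTorsion 2 π r))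
      (c' : subgroupH1 (⊤ : Subgroup (absoluteGaloisGroup K)) ↥((W.baseChange K).endEigenPrimaryTorsion 2 π (1 - r))),
      η ∈ (W.baseChange K).localKerOver 2 ⊤ (vbar.adicCompletion K) →
      η = resH1Hom (ContinuousMonoidHom.id _) ((W.baseChange K).endEigenPrimaryTorsion 2 π r).subtype (fun _ _ ↦ rfl) c +
        resH1Hom (ContinuousMonoidHom.id _) ((W.baseChange K).endEigenPrimaryTorsion 2 π (1 - r)).subtype (fun _ _ ↦ rfl) c' →
      resH1Hom (ContinuousMonoidHom.id _) ((W.baseChange K).endEigenPrimaryTorsion 2 π r).subtype (fun _ _ ↦ rfl) c ∈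
        (W.baseChange K).localKerOver 2 ⊤ (vbar.adicCompletion K)) :
    Nat.card (↥(restrictedSelmerBase ↥((W.baseChange K).endEigenPrimaryTorsion 2 π r) 2 v ⊓
            (((W.baseChange K).localKerOver 2 ⊤ (vbar.adicCompletion K)).comap
          (resH1Hom (ContinuousMonoidHom.id _) ((W.baseChange K).endEigenPrimaryTorsion 2 π r).subtype (fun _ _ ↦ rfl)))) ⧸
          (((((W.baseChange K).kummerMapPInfty 2 (W.baseChange K).zsmul_geomPoints_surjective_holds).range).map
            (resSubgroup ⊤ ((W.baseChange K).geomPrimaryTorsion 2))).comap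
          (resH1Hom (ContinuousMonoidHom.id _) ((W.baseChange K).endEigenPrimaryTorsion 2 π r).subtype (fun _ _ ↦ rfl))).addSubgroupOf
            (restrictedSelmerBase ↥((W.baseChange K).endEigenPrimaryTorsion 2 π r) 2 v ⊓
              (((W.baseChange K).localKerOver 2 ⊤ (vbar.adicCompletion K)).comap
          (resH1Hom (ContinuousMonoidHom.id _) ((W.baseChange K).endEigenPrimaryTorsion 2 π r).subtype (fun _ _ ↦ rfl))))) =
      Nat.card (AddCommGroup.primaryComponent W.sha 2) := by
  -- the frame's supplies
  have hπg : (π : AddMonoid.End (W.baseChange K).geomPoints) ∈ (W.baseChange K).geomEndRing := (W.baseChange K).endRing_le_geomEndRing π.2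
  have hπG : ∀ (g : absoluteGaloisGroup K) (P : (W.baseChange K).geomPoints),
      (π : AddMonoid.End (W.baseChange K).geomPoints) (g • P) = g • (π : AddMonoid.End (W.baseChange K).geomPoints) P :=
    ((W.baseChange K).mem_equivariantSubring_iff _).mp (Subring.mem_inf.mp π.2).2
  obtain ⟨φ, hφ, hrelφ⟩ := exists_isogeny_apply_eq_cmEndo (W.baseChange K) hπg hπG hrel
  obtain ⟨hinf, hsup⟩ := endEigenPrimaryTorsion_compl_of_frame hd0 W C hCW K π hrel hr
  have hu : IsUnit (2 * r - 1) := by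
    have h := (two_dvd_or_two_dvd_one_sub_of_root hr).2
    rwa [show r - (1 - r) = 2 * r - 1 by ring] at h
  have hall : ∀ w : HeightOneSpectrum (𝓞 K), ((2 : ℕ) : 𝓞 K) ∈ w.asIdeal → w = v ∨ w = vbar :=
    fun w hw ↦ eq_or_eq_of_two_mem K hK.1 hv hvbar hne hw
  obtain ⟨θ, hθ⟩ := exists_sq_eq_neg_seven_of_frame_cmEndo hd0 W C hCW π hrel
  have hj : W.j = -3375 := j_eq_of_smul_eq_cm7Twist hd0 W C hCW
  -- THE `r`-eigen subgroup of `Ш(E_K/K)[2^∞]` and its partner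
  set Msha := ↥(AddCommGroup.primaryComponent (W.baseChange K).sha 2) with hMsha
  obtain ⟨πM, hπM, -⟩ := exists_shaPi_two (W.baseChange K) φ hrelφ
  obtain ⟨C₁, hC₁⟩ := exists_addSubgroup_eigen (p := 2) exists_two_pow_smul_eq_zero_primaryComponent πM r
  obtain ⟨C₂, hC₂⟩ := exists_addSubgroup_eigen (p := 2) exists_two_pow_smul_eq_zero_primaryComponent πM (1 - r)
  have hcoe : ∀ (x : Msha) (N : ℤ), πM x = N • x ↔
      galH1Map φ.toAddMonoidHom φ.equivariant (((x : Msha) : (W.baseChange K).sha) : (W.baseChange K).galH1) = N • (((x : Msha) : (W.baseChange K).sha) : (W.baseChange K).galH1) := fun x N ↦ by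
    rw [← hπM x]
    constructor
    · intro h; rw [h, AddSubgroupClass.coe_zsmul, AddSubgroupClass.coe_zsmul]
    · intro h
      apply Subtype.ext; apply Subtype.ext
      rw [h, AddSubgroupClass.coe_zsmul, AddSubgroupClass.coe_zsmul]
  have hC : ∀ x : Msha, x ∈ C₁ ↔ ∀ (k : ℕ) (N : ℤ), 2 ^ k • x = 0 →
      ((N : ℤ_[2]) - r) ∈ (Ideal.span {(2 : ℤ_[2]) ^ k} : Ideal ℤ_[2]) →
        galH1Map φ.toAddMonoidHom φ.equivariant (((x : Msha) : (W.baseChange K).sha) : (W.baseChange K).galH1) = N • (((x : Msha) : (W.baseChange K).sha) : (W.baseChange K).galH1) := fun x ↦ by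
    rw [hC₁ x]
    exact forall_congr' fun k ↦ forall_congr' fun N ↦ forall_congr' fun _ ↦ forall_congr' fun _ ↦ hcoe x N
  have hC' : ∀ x : Msha, x ∈ C₂ ↔ ∀ (k : ℕ) (N : ℤ), 2 ^ k • x = 0 →
      ((N : ℤ_[2]) - (1 - r)) ∈ (Ideal.span {(2 : ℤ_[2]) ^ k} : Ideal ℤ_[2]) →
        galH1Map φ.toAddMonoidHom φ.equivariant (((x : Msha) : (W.baseChange K).sha) : (W.baseChange K).galH1) = N • (((x : Msha) : (W.baseChange K).sha) : (W.baseChange K).galH1) := fun x ↦ by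
    rw [hC₂ x]
    exact forall_congr' fun k ↦ forall_congr' fun N ↦ forall_congr' fun _ ↦ forall_congr' fun _ ↦ hcoe x N
  -- the three counts
  have h1 := (natCard_trueSelmer_quotient_eq_natCard_range_shaMap (W.baseChange K) 2 π r v vbar hK hall).1
  have h2 := natCard_range_shaBridge_trueSelmer_eq (W.baseChange K) 2 π r v vbar hK hall hu hinf hsup φ hφ Hv Hvbar hC
  have h3 := (natCard_cmPrimary_sha_eq_of_isogeny W hj hK hθ φ hrelφ hr hC hC').1
  exact h1.trans (h2.trans h3)

/-- **Factor (F2) on the frame, `v₂` form — the inner statement of -w7 g2's hypothesis `hF2` of `rBV_of_three_factor_values`, VERBATIM,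
under the two displayed local CM inputs (Hv), (Hv̄)**: `v₂ #((𝔖_v(K, E[𝔮^∞]) ⊓ L_M) ⧸ Q_M) = v₂ #Ш(W/ℚ)[2^∞]`.
[cite: Agboola2007, Props. 6.10–6.11 (arXiv p0014:L1–p0015:L12)] [cite: GrossLMS1991, §5 (5.1)] -/
theorem padicValNat_trueSelmer_quotient_eq_sha_of_frame {d : ℤ} (hd0 : d ≠ 0) (W : WeierstrassCurve ℚ) [W.IsElliptic]
    (C : WeierstrassCurve.VariableChange ℚ) (hCW : C • W = cm7.quadraticTwist (d : ℚ)) (hK : IsImaginaryQuadratic K)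
    (v vbar : HeightOneSpectrum (𝓞 K)) (hv : ((2 : ℕ) : 𝓞 K) ∈ v.asIdeal) (hvbar : ((2 : ℕ) : 𝓞 K) ∈ vbar.asIdeal) (hne : vbar ≠ v)
    (π : (W.baseChange K).endRing) (hrel : (π : AddMonoid.End (W.baseChange K).geomPoints) * π = π - 2)
    {r : ℤ_[2]} (hr : r * r = r - 2)
    (Hv : ∀ (η : subgroupH1 (⊤ : Subgroup (absoluteGaloisGroup K)) ↥((W.baseChange K).geomPrimaryTorsion 2))
      (c : subgroupH1 (⊤ : Subgroup (absoluteGaloisGroup K)) ↥((W.baseChange K).endEigenPrimaryTorsion 2 π r))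
      (c' : subgroupH1 (⊤ : Subgroup (absoluteGaloisGroup K)) ↥((W.baseChange K).endEigenPrimaryTorsion 2 π (1 - r))),
      η ∈ (W.baseChange K).localKerOver 2 ⊤ (v.adicCompletion K) →
      η = resH1Hom (ContinuousMonoidHom.id _) ((W.baseChange K).endEigenPrimaryTorsion 2 π r).subtype (fun _ _ ↦ rfl) c +
        resH1Hom (ContinuousMonoidHom.id _) ((W.baseChange K).endEigenPrimaryTorsion 2 π (1 - r)).subtype (fun _ _ ↦ rfl) c' →
      Literature.NumberTheory.EllipticCurves.resOfLe ↥((W.baseChange K).endEigenPrimaryTorsion 2 π r)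
        (inf_le_left : ⊤ ⊓ decomp v ≤ ⊤) c = 0)
    (Hvbar : ∀ (η : subgroupH1 (⊤ : Subgroup (absoluteGaloisGroup K)) ↥((W.baseChange K).geomPrimaryTorsion 2))
      (c : subgroupH1 (⊤ : Subgroup (absoluteGaloisGroup K)) ↥((W.baseChange K).endEigenPrimaryTorsion 2 π r))
      (c' : subgroupH1 (⊤ : Subgroup (absoluteGaloisGroup K)) ↥((W.baseChange K).endEigenPrimaryTorsion 2 π (1 - r))),
      η ∈ (W.baseChange K).localKerOver 2 ⊤ (vbar.adicCompletion K) →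
      η = resH1Hom (ContinuousMonoidHom.id _) ((W.baseChange K).endEigenPrimaryTorsion 2 π r).subtype (fun _ _ ↦ rfl) c +
        resH1Hom (ContinuousMonoidHom.id _) ((W.baseChange K).endEigenPrimaryTorsion 2 π (1 - r)).subtype (fun _ _ ↦ rfl) c' →
      resH1Hom (ContinuousMonoidHom.id _) ((W.baseChange K).endEigenPrimaryTorsion 2 π r).subtype (fun _ _ ↦ rfl) c ∈
        (W.baseChange K).localKerOver 2 ⊤ (vbar.adicCompletion K)) :
    padicValNat 2 (Nat.card (↥(restrictedSelmerBase ↥((W.baseChange K).endEigenPrimaryTorsion 2 π r) 2 v ⊓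
            (((W.baseChange K).localKerOver 2 ⊤ (vbar.adicCompletion K)).comap
          (resH1Hom (ContinuousMonoidHom.id _) ((W.baseChange K).endEigenPrimaryTorsion 2 π r).subtype (fun _ _ ↦ rfl)))) ⧸
          (((((W.baseChange K).kummerMapPInfty 2 (W.baseChange K).zsmul_geomPoints_surjective_holds).range).map
            (resSubgroup ⊤ ((W.baseChange K).geomPrimaryTorsion 2))).comap
          (resH1Hom (ContinuousMonoidHom.id _) ((W.baseChange K).endEigenPrimaryTorsion 2 π r).subtype (fun _ _ ↦ rfl))).addSubgroupOf
            (restrictedSelmerBase ↥((W.baseChange K).endEigenPrimaryTorsion 2 π r) 2 v ⊓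
              (((W.baseChange K).localKerOver 2 ⊤ (vbar.adicCompletion K)).comap
          (resH1Hom (ContinuousMonoidHom.id _) ((W.baseChange K).endEigenPrimaryTorsion 2 π r).subtype (fun _ _ ↦ rfl)))))) =
      padicValNat 2 (Nat.card (AddCommGroup.primaryComponent W.sha 2)) := by
  rw [natCard_trueSelmer_quotient_eq_sha_of_frame hd0 W C hCW hK v vbar hv hvbar hne π hrel hr Hv Hvbar]

end Summit.BirchSwinnertonDyer.BirchSwinnertonDyer.Theorems.PrintCf2.CMPrimes

end
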